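import Mathlib
import Literature.Probability.Percolation.SitePaths
import Literature.Probability.Percolation.SiteInterfaceSeparation
import Literature.Probability.Percolation.SiteInterfaceWindingSigns
import Literature.Probability.Percolation.SiteInterfaceReverse
import Literature.Probability.RandomPlanarGeometry.PolylineUniform
import Literature.Probability.Percolation.SiteNestingWeightBound
import Literature.Probability.Percolation.MacroscopicInterfaceLoop
import Literature.Probability.Percolation.FullPlaneCNL
import Literature.Probability.LatticeModels.TriangularLatticeProofs
import Summits.CriticalPhenomena.CardyFormulaZ2.Theorems.CardyMagicRigidityHexSegmentDefs
import HarnessLib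

/-!
# Stub `stub_siteEnd` (S2) of line `Sketch`, crux `LoopLimitZ2EqT` (stmt-CriticalPhenomena-4833):
# interface loops of a site configuration on `𝕋` ↔ its finite monochromatic clusters

Helper file (`--supports stmt-CriticalPhenomena-4833`): the **loops ↔ clusters dictionary** for
the typed honeycomb interface loops of an ARBITRARY site configuration `ω` on the triangular
lattice (`IsSiteInterfaceLoop`, `CLE6.lean`; typed as in `siteLoopConfig`, `FullPlaneCNL.lean`:
type `1` iff positive shoelace sum iff anticlockwise), i.e. DKKMO's reading of the two types
("`F₁` = exterior boundaries of primal clusters, `F₀` = exterior boundaries of dual clusters",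
arXiv:2012.11672v2 §1.2) made precise and proved from the tree's winding-number theory
(`SiteInterfaceWinding*.lean`, `SiteInterfaceSeparation.lean`, no Jordan curve theorem):

* `siteEnd_polyTrace_subset_closedBall`, `siteEnd_loopWind_eq_zero_of_lt_dist` — the polygon of
  an interface loop of length `n` stays within `n δ` of its first left point, and does not wind
  about farther points;
* `siteEnd_finite_cluster_of_shoelace_pos` — **the open cluster on the left of a type-`1` loop
  is finite** (it has winding number `1`, far sites have winding number `0`);
* `siteEnd_loopWind_eq_zero_of_lt_apply` — no winding to the right of the left sites (transport
  along the lattice ray `b + k e₀`, which avoids the left sites);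
* **`siteEnd_exists_loop_of_finite`** — **every finite open cluster is the left cluster of a
  type-`1` interface loop** (its outer boundary: the separating loop of
  `exists_isSiteInterfaceLoop_loopWind_eq` through the edge to the right of the rightmost site
  `c⋆` of the cluster winds `m` about the cluster, `m - 1` and `0` about `c⋆ + e₀`, so `m = 1`);
* `siteEnd_hexDart_mem_darts`, **`siteEnd_unbasedLoop_eq_of_pathIn`** — **uniqueness**: a
  type-`1` loop crosses the dart `hexDart c⋆ 5` at the rightmost site of its left cluster, so two
  type-`1` loops with left sites in the same cluster pass through a common face and define the
  same unbased loop at every mesh (`exists_rebase`, `eq_of_base_eq`);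
* the type-`0` mirror images by colour reversal (`reverse_compl`, `shoelace_reverse`,
  `siteEnd_unbasedLoop_reverse`): `siteEnd_finite_cluster_of_shoelace_nonpos`,
  `siteEnd_exists_loop_of_finite_compl`, `siteEnd_unbasedLoop_eq_of_pathIn_compl` — type-`0`
  loops ↔ finite closed clusters (the closed cluster on the right).

Hence the members of `(siteLoopConfig δ ω).F 1` are in bijection with the finite open clusters
of `ω` and those of `F 0` with the finite closed clusters. Combined with the cluster-level arena
identity (`CardyMagicRigidityLoopLimitZ2EqTSiteEndClusters.lean`: clusters of the blow-up `β τ`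
↔ clusters of `τ`, plus isolated corners) this gives the combinatorial half of the loop
dictionary of `CardyMagicRigidityLoopLimitZ2EqTSiteEndAssembly.lean`; the metric half (the
`udist ≤ C δ` fellow-travelling of corresponding outer boundaries at meshes `δ` and `δ/2`)
remains.
-/

noncomputable section

open Set Metric

namespace Summit.CriticalPhenomena.CardyFormulaZ2.Cruxes.LoopLimitZ2EqT.HexSegment

open Literature.Probability.Percolation Literature.Probability.LatticeModels
  Literature.Probability.RandomPlanarGeometry

variable {ω : SiteConfig (Site 2)} {f₀ : HexVertex} {w : hexGraph.Walk f₀ f₀}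

/-! ### The trace of an interface loop stays near its first left site -/

/-- Consecutive left points are within `δ`, so the `i`-th is within `i δ` of the first. -/
theorem siteEnd_dist_leftPt_zero_le (hw : IsSiteInterfaceLoop ω w) {δ : ℝ} (hδ : 0 ≤ δ) :
    ∀ {i : ℕ}, i < w.length → dist (hw.leftPt δ 0) (hw.leftPt δ i) ≤ i * δ
  | 0, _ => by simp
  | i + 1, hi => by
    calc dist (hw.leftPt δ 0) (hw.leftPt δ (i + 1))
        ≤ dist (hw.leftPt δ 0) (hw.leftPt δ i) + dist (hw.leftPt δ i) (hw.leftPt δ (i + 1)) :=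
          dist_triangle _ _ _
      _ ≤ i * δ + δ := add_le_add (siteEnd_dist_leftPt_zero_le hw hδ (by omega))
          (hw.dist_leftPt_succ_le hδ hi)
      _ = (i + 1 : ℕ) * δ := by push_cast; ring

/-- **The trace of an interface loop of length `n` lies in the ball of radius `n δ` about its
first left point.** -/
theorem siteEnd_polyTrace_subset_closedBall (hw : IsSiteInterfaceLoop ω w) {δ : ℝ} (hδ : 0 ≤ δ) :
    polyTrace δ w ⊆ closedBall (hw.leftPt δ 0) (w.length * δ) := by
  intro z hz
  obtain ⟨i, hi, hzi⟩ := mem_polyTrace_iff.1 hz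
  have h1 : dist z (hw.leftPt δ i) ≤ δ := hw.polyPiece_subset_closedBall hδ hi hzi
  have h2 := siteEnd_dist_leftPt_zero_le hw hδ hi
  rw [mem_closedBall]
  calc dist z (hw.leftPt δ 0) ≤ dist z (hw.leftPt δ i) + dist (hw.leftPt δ 0) (hw.leftPt δ i) := by
          rw [dist_comm (hw.leftPt δ 0)]; exact dist_triangle _ _ _
    _ ≤ δ + i * δ := add_le_add h1 h2
    _ ≤ w.length * δ := by
        have : (i : ℝ) + 1 ≤ w.length := by exact_mod_cast hi
        nlinarith

/-- The interface polygon does not wind about mesh points farther than `n δ` from the first left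
point. -/
theorem siteEnd_loopWind_eq_zero_of_lt_dist (hw : IsSiteInterfaceLoop ω w) {δ : ℝ} (hδ : 0 ≤ δ)
    {z : ℂ} (hz : w.length * δ < dist z (hw.leftPt δ 0)) : loopWind δ w z = 0 := by
  have hlen : 0 < w.length := by have := hw.isCycle.three_le_length; omega
  exact loopWind_eq_zero_of_lt_dist hlen (siteEnd_polyTrace_subset_closedBall hw hδ) hz

/-! ### Type-`1` loops: the open cluster on the left is finite -/

/-- **The left cluster of a type-`1` interface loop is finite**: its sites have winding number
`1` (`loopWind_leftPt_eq_one_of_shoelace_pos`, transport along open paths), while the polygon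
does not wind about far sites. -/
theorem siteEnd_finite_cluster_of_shoelace_pos (hw : IsSiteInterfaceLoop ω w)
    (hpos : 0 < shoelace (w.support.map hexCenter)) :
    {x : Site 2 | PathIn triGraph ω (hw.lv 0) x}.Finite := by
  have hlen : 0 < w.length := by have := hw.isCycle.three_le_length; omega
  have h1 : loopWind 1 w (hw.leftPt 1 0) = 1 := hw.loopWind_leftPt_eq_one_of_shoelace_pos one_pos hpos hlen
  refine (triMeshVertices_finite_holds (Ω := closedBall (hw.leftPt 1 0) (w.length * 1))
    isBounded_closedBall one_pos).subset fun x hx => ?_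
  rw [mem_triMeshVertices_iff, mem_closedBall]
  by_contra hfar
  have h0 := siteEnd_loopWind_eq_zero_of_lt_dist hw zero_le_one (not_le.1 hfar)
  have h2 := hw.loopWind_eq_of_pathIn_of_mem one_pos hx
  rw [IsSiteInterfaceLoop.leftPt] at h1
  rw [← h2, h1] at h0
  exact one_ne_zero h0

/-! ### The ray to the right of the cluster -/

/-- **No winding to the right of the left sites.** If every left site of the interface loop has
first coordinate `≤ c 0` and `b` has first coordinate `> c 0`, the polygon (mesh `1`) does not
wind about `b`: the lattice ray `b, b + e₀, b + 2e₀, …` avoids the left sites, so the winding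
number is constant along it (`loopWind_eq_of_pathIn_of_lv_not_mem`), and it vanishes far out. -/
theorem siteEnd_loopWind_eq_zero_of_lt_apply (hw : IsSiteInterfaceLoop ω w) {c b : Site 2}
    (hmax : ∀ j < w.length, hw.lv j 0 ≤ c 0) (hb : c 0 < b 0) :
    loopWind 1 w (triMeshPoint 1 b) = 0 := by
  set A : Set (Site 2) := {x | c 0 < x 0} with hA
  have hlvA : ∀ j < w.length, hw.lv j ∉ A := fun j hj h => (not_lt.2 (hmax j hj)) h
  have hray0 : ∀ k : ℕ, raySite b k 0 = b 0 + k := fun k => by simp [raySite]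
  have hrayA : ∀ k : ℕ, raySite b k ∈ A := fun k => by
    show c 0 < raySite b k 0
    rw [hray0]; have := (k : ℤ).le_refl; omega
  have hpath : ∀ k : ℕ, PathIn triGraph A b (raySite b k) := by
    intro k
    induction k with
    | zero => rw [raySite_zero]; exact PathIn.refl (by simpa using hrayA 0)
    | succ k ih => exact ih.tail (adj_raySite_succ b k) (hrayA (k + 1))
  -- a far ray site
  set k : ℕ := w.length + ⌈‖triEmbed (b - hw.lv 0)‖⌉₊ + 1 with hk
  have hfar : (w.length : ℝ) * 1 < dist (triMeshPoint 1 (raySite b k)) (hw.leftPt 1 0) := by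
    rw [IsSiteInterfaceLoop.leftPt, triMeshPoint, triMeshPoint, Complex.ofReal_one, one_mul, one_mul,
      dist_eq_norm, ← triEmbed_sub, mul_one]
    have h1 := sub_le_norm_triEmbed_raySite_sub b (hw.lv 0) k
    have h2 : ‖triEmbed (b - hw.lv 0)‖ ≤ ⌈‖triEmbed (b - hw.lv 0)‖⌉₊ := Nat.le_ceil _
    have h3 : (k : ℝ) = w.length + ⌈‖triEmbed (b - hw.lv 0)‖⌉₊ + 1 := by rw [hk]; push_cast; ring
    linarith
  rw [hw.loopWind_eq_of_pathIn_of_lv_not_mem one_pos hlvA (hpath k)]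
  exact siteEnd_loopWind_eq_zero_of_lt_dist hw zero_le_one hfar

/-! ### Existence: the outer boundary of a finite open cluster is a type-`1` interface loop -/

/-- **Every finite open cluster is the left cluster of a type-`1` interface loop** (its outer
boundary). With `c⋆` a site of the cluster `C` of `u₀` with maximal first coordinate and
`b = c⋆ + e₀` (closed, as it is not in `C`), the separating loop of `SiteInterfaceSeparation`
(`exists_isSiteInterfaceLoop_loopWind_eq`) has its left sites in `C`, winds `m` about `C` and
`m - 1` about `b`; but it does not wind about `b` (`siteEnd_loopWind_eq_zero_of_lt_apply`), so
`m = 1` and the loop has type `1` (`shoelace_pos_iff`). -/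
theorem siteEnd_exists_loop_of_finite : ∀ {ω : SiteConfig (Site 2)} {u₀ : Site 2}, u₀ ∈ ω →
    {x : Site 2 | PathIn triGraph ω u₀ x}.Finite →
    ∃ (F : HexVertex) (w : hexGraph.Walk F F) (hw : IsSiteInterfaceLoop ω w),
      0 < shoelace (w.support.map hexCenter) ∧ ∀ i < w.length, PathIn triGraph ω u₀ (hw.lv i) := by
  intro ω u₀ hu₀ hfin
  obtain ⟨c, hc, hmax⟩ := Set.exists_max_image _ (fun x : Site 2 => x 0) hfin ⟨u₀, PathIn.refl hu₀⟩
  set b : Site 2 := c + Pi.single 0 1 with hb_def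
  have hb0 : b 0 = c 0 + 1 := by simp [hb_def]
  have hcb : triGraph.Adj c b := triGraph_adj_self_add_single c 0
  have hb : b ∉ ω := fun hbω => by
    have : b 0 ≤ c 0 := hmax b (hc.tail hcb hbω)
    omega
  obtain ⟨F, w, hw, hlv, hC, hD⟩ := exists_isSiteInterfaceLoop_loopWind_eq one_pos hfin hu₀ hb
  have hlen : 0 < w.length := by have := hw.isCycle.three_le_length; omega
  refine ⟨F, w, hw, (hw.shoelace_pos_iff one_pos).2 ?_, hlv⟩
  have hWb : loopWind 1 w (triMeshPoint 1 b) = 0 :=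
    siteEnd_loopWind_eq_zero_of_lt_apply hw (c := c) (fun j hj => hmax _ (hlv j hj)) (by omega)
  have hDb := hD b (PathIn.refl hb)
  have hC0 := hC (hw.lv 0) (hlv 0 hlen)
  rw [IsSiteInterfaceLoop.leftPt, hC0]
  omega

/-! ### Uniqueness: a type-`1` interface loop is determined by its left cluster -/

/-- `hexDir 5 = e₀`. -/
theorem siteEnd_hexDir_five : hexDir 5 = Pi.single 0 1 := rfl

/-- **A type-`1` interface loop crosses the edge to the right of the rightmost site of its left
cluster**: if `c` is joined to `lv 0` by open sites and has maximal first coordinate among such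
sites, the hexagon dart `hexDart c 5` (crossing `{c, c + e₀}` with `c` on its left) is a dart of
the loop — the winding number is `1` at `c` (type `1`, transport) and `0` at `c + e₀`
(`siteEnd_loopWind_eq_zero_of_lt_apply`), and this gradient is the signed crossing indicator
(`loopWind_sub_loopWind_add_hexDir`). -/
theorem siteEnd_hexDart_mem_darts (hw : IsSiteInterfaceLoop ω w)
    (hpos : 0 < shoelace (w.support.map hexCenter)) {c : Site 2}
    (hc : PathIn triGraph ω (hw.lv 0) c) (hmax : ∀ x, PathIn triGraph ω (hw.lv 0) x → x 0 ≤ c 0) :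
    hexDart c 5 ∈ w.darts := by
  have hlen : 0 < w.length := by have := hw.isCycle.three_le_length; omega
  have h1 : loopWind 1 w (triMeshPoint 1 c) = 1 := by
    rw [← hw.loopWind_eq_of_pathIn_of_mem one_pos hc]
    exact hw.loopWind_leftPt_eq_one_of_shoelace_pos one_pos hpos hlen
  have h0 : loopWind 1 w (triMeshPoint 1 (c + hexDir 5)) = 0 := by
    refine siteEnd_loopWind_eq_zero_of_lt_apply hw (c := c) (fun j hj => hmax _ (hw.pathIn_lv hj)) ?_
    rw [siteEnd_hexDir_five]; simp
  have key := hw.loopWind_sub_loopWind_add_hexDir one_pos c 5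
  rw [h1, h0] at key
  by_contra hmem
  rw [if_neg hmem] at key
  split_ifs at key <;> omega

/-- **Two type-`1` interface loops of `ω` whose left sites lie in the same open cluster are the
same unbased loop** at every mesh: both cross the dart `hexDart c⋆ 5` at the rightmost site `c⋆`
of the (finite) cluster (`siteEnd_hexDart_mem_darts`), hence both pass through its tail face;
rebased there (`IsSiteInterfaceLoop.exists_rebase`) they coincide (`eq_of_base_eq`). So the
type-`1` loops of `siteLoopConfig δ ω` correspond one-to-one to the finite open clusters of `ω`
(DKKMO's "exterior boundaries of primal clusters"). -/
theorem siteEnd_unbasedLoop_eq_of_pathIn : ∀ {ω : SiteConfig (Site 2)} {f₁ f₂ : HexVertex}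
    {w₁ : hexGraph.Walk f₁ f₁} {w₂ : hexGraph.Walk f₂ f₂} (hw₁ : IsSiteInterfaceLoop ω w₁)
    (hw₂ : IsSiteInterfaceLoop ω w₂), 0 < shoelace (w₁.support.map hexCenter) →
    0 < shoelace (w₂.support.map hexCenter) → PathIn triGraph ω (hw₁.lv 0) (hw₂.lv 0) → ∀ δ : ℝ,
    UnbasedLoop.mk (BasedLoop.mk (siteLoopCurve δ w₁) (isLoop_siteLoopCurve δ w₁)) =
      UnbasedLoop.mk (BasedLoop.mk (siteLoopCurve δ w₂) (isLoop_siteLoopCurve δ w₂)) := by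
  intro ω f₁ f₂ w₁ w₂ hw₁ hw₂ h₁ h₂ h δ
  have hfin := siteEnd_finite_cluster_of_shoelace_pos hw₁ h₁
  obtain ⟨c, hc, hmax⟩ := Set.exists_max_image _ (fun x : Site 2 => x 0) hfin ⟨hw₁.lv 0, PathIn.refl h.left_mem⟩
  have hd₁ : hexDart c 5 ∈ w₁.darts := siteEnd_hexDart_mem_darts hw₁ h₁ hc hmax
  have hd₂ : hexDart c 5 ∈ w₂.darts :=
    siteEnd_hexDart_mem_darts hw₂ h₂ (h.symm.trans hc) fun x hx => hmax x (h.trans hx)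
  obtain ⟨w₁', hw₁', e₁⟩ := hw₁.exists_rebase (w₁.dart_fst_mem_support_of_mem_darts hd₁) δ
  obtain ⟨w₂', hw₂', e₂⟩ := hw₂.exists_rebase (w₂.dart_fst_mem_support_of_mem_darts hd₂) δ
  rw [← e₁, ← e₂, hw₁'.eq_of_base_eq hw₂']


/-! ### Type-`0` loops: the same dictionary for the closed cluster on the right, by reversal -/

/-- **Reversing a closed honeycomb walk reverses its unbased loop**: the polyline through the
reversed vertex list is the time reversal of the polyline (`reverse_mk_polyline`). -/
theorem siteEnd_unbasedLoop_reverse (δ : ℝ) (w : hexGraph.Walk f₀ f₀) :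
    UnbasedLoop.mk (BasedLoop.mk (siteLoopCurve δ w.reverse) (isLoop_siteLoopCurve δ w.reverse)) =
      (UnbasedLoop.mk (BasedLoop.mk (siteLoopCurve δ w) (isLoop_siteLoopCurve δ w))).reverse := by
  rw [UnbasedLoop.reverse_mk]
  congr 1
  rw [BasedLoop.reverse, BasedLoop.mk_eq_mk, BasedLoop.toCurveClass_mk]
  show CurveClass.mk ⟨polyline (w.reverse.support.map fun v => (δ : ℂ) * hexCenter v)⟩ =
    (CurveClass.mk ⟨polyline (w.support.map fun v => (δ : ℂ) * hexCenter v)⟩).reverse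
  rw [Polyline.reverse_mk_polyline, SimpleGraph.Walk.support_reverse, List.map_reverse]

/-- A type-`0` interface loop (non-positive shoelace sum) has negative shoelace sum, and its
reversal — an interface loop of `ωᶜ` — has type `1`. -/
theorem siteEnd_shoelace_reverse_pos (hw : IsSiteInterfaceLoop ω w)
    (h0 : shoelace (w.support.map hexCenter) ≤ 0) :
    0 < shoelace (w.reverse.support.map hexCenter) := by
  rw [SimpleGraph.Walk.support_reverse, List.map_reverse, shoelace_reverse, neg_pos]
  exact lt_of_le_of_ne h0 (hw.shoelace_ne_zero one_pos)

/-- The right sites of an interface loop lie in the closed cluster of the first one. -/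
theorem siteEnd_pathIn_rv (hw : IsSiteInterfaceLoop ω w) {j : ℕ} (hj : j < w.length) :
    PathIn triGraph ωᶜ (hw.rv 0) (hw.rv j) := by
  have hlen : 0 < w.length := by omega
  obtain ⟨y, hy, hp⟩ := hw.exists_pathIn_rv (T := {hw.rv 0})
    ⟨hw.rv 0, rfl, PathIn.refl (hw.rv_not_mem hlen)⟩ hj
  rw [mem_singleton_iff] at hy
  rw [hy] at hp
  exact hp.symm

/-- **The right cluster of a type-`0` interface loop is finite** (reversal of
`siteEnd_finite_cluster_of_shoelace_pos`). -/
theorem siteEnd_finite_cluster_of_shoelace_nonpos (hw : IsSiteInterfaceLoop ω w)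
    (h0 : shoelace (w.support.map hexCenter) ≤ 0) :
    {x : Site 2 | PathIn triGraph ωᶜ (hw.rv 0) x}.Finite := by
  have hlen : 0 < w.length := by have := hw.isCycle.three_le_length; omega
  have hfin := siteEnd_finite_cluster_of_shoelace_pos hw.reverse_compl (siteEnd_shoelace_reverse_pos hw h0)
  rw [hw.lv_reverse hlen] at hfin
  have hp : PathIn triGraph ωᶜ (hw.rv 0) (hw.rv (w.length - 1 - 0)) := siteEnd_pathIn_rv hw (by omega)
  exact hfin.subset fun x hx => hp.symm.trans hx

/-- The right sites of an interface loop do not depend on how the configuration is written. -/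
theorem siteEnd_rv_congr {ω₁ ω₂ : SiteConfig (Site 2)} (h : ω₁ = ω₂) {w : hexGraph.Walk f₀ f₀}
    (h₁ : IsSiteInterfaceLoop ω₁ w) (h₂ : IsSiteInterfaceLoop ω₂ w) (i : ℕ) : h₁.rv i = h₂.rv i := by
  subst h; rfl

/-- **Every finite closed cluster is the right cluster of a type-`0` interface loop** (reversal
of `siteEnd_exists_loop_of_finite` in `ωᶜ`). -/
theorem siteEnd_exists_loop_of_finite_compl {v₀ : Site 2} (hv₀ : v₀ ∉ ω)
    (hfin : {x : Site 2 | PathIn triGraph ωᶜ v₀ x}.Finite) :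
    ∃ (F : HexVertex) (w : hexGraph.Walk F F) (hw : IsSiteInterfaceLoop ω w),
      shoelace (w.support.map hexCenter) ≤ 0 ∧ ∀ i < w.length, PathIn triGraph ωᶜ v₀ (hw.rv i) := by
  obtain ⟨F, w, hw, hpos, hlv⟩ := siteEnd_exists_loop_of_finite (ω := ωᶜ) hv₀ hfin
  have hw₁ : IsSiteInterfaceLoop ωᶜᶜ w.reverse := hw.reverse_compl
  have hw' : IsSiteInterfaceLoop ω w.reverse := by rwa [compl_compl] at hw₁
  refine ⟨F, w.reverse, hw', ?_, fun i hi => ?_⟩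
  · rw [SimpleGraph.Walk.support_reverse, List.map_reverse, shoelace_reverse, neg_nonpos]
    exact hpos.le
  · rw [SimpleGraph.Walk.length_reverse] at hi
    rw [siteEnd_rv_congr (compl_compl ω).symm hw' hw₁ i, hw.rv_reverse hi]
    exact hlv _ (by omega)

/-- **Two type-`0` interface loops of `ω` whose right sites lie in the same closed cluster are
the same unbased loop** (reversal of `siteEnd_unbasedLoop_eq_of_pathIn` in `ωᶜ`). So the
type-`0` loops of `siteLoopConfig δ ω` correspond one-to-one to the finite closed clusters of
`ω` ("exterior boundaries of dual clusters"). -/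
theorem siteEnd_unbasedLoop_eq_of_pathIn_compl {f₁ f₂ : HexVertex} {w₁ : hexGraph.Walk f₁ f₁}
    {w₂ : hexGraph.Walk f₂ f₂} (hw₁ : IsSiteInterfaceLoop ω w₁) (hw₂ : IsSiteInterfaceLoop ω w₂)
    (h₁ : shoelace (w₁.support.map hexCenter) ≤ 0) (h₂ : shoelace (w₂.support.map hexCenter) ≤ 0)
    (h : PathIn triGraph ωᶜ (hw₁.rv 0) (hw₂.rv 0)) (δ : ℝ) :
    UnbasedLoop.mk (BasedLoop.mk (siteLoopCurve δ w₁) (isLoop_siteLoopCurve δ w₁)) =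
      UnbasedLoop.mk (BasedLoop.mk (siteLoopCurve δ w₂) (isLoop_siteLoopCurve δ w₂)) := by
  have hl₁ : 0 < w₁.length := by have := hw₁.isCycle.three_le_length; omega
  have hl₂ : 0 < w₂.length := by have := hw₂.isCycle.three_le_length; omega
  have key := siteEnd_unbasedLoop_eq_of_pathIn hw₁.reverse_compl hw₂.reverse_compl
    (siteEnd_shoelace_reverse_pos hw₁ h₁) (siteEnd_shoelace_reverse_pos hw₂ h₂) ?_ δ
  · rw [siteEnd_unbasedLoop_reverse, siteEnd_unbasedLoop_reverse] at key
    rw [← UnbasedLoop.reverse_reverse (UnbasedLoop.mk _), key, UnbasedLoop.reverse_reverse]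
  · rw [hw₁.lv_reverse hl₁, hw₂.lv_reverse hl₂]
    exact (siteEnd_pathIn_rv hw₁ (by omega)).symm.trans (h.trans (siteEnd_pathIn_rv hw₂ (by omega)))

end Summit.CriticalPhenomena.CardyFormulaZ2.Cruxes.LoopLimitZ2EqT.HexSegment

end
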